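/-
Copyright (c) 2026 the pub-hodgecm-mathlib formalisation cell (harness21).  Prover seat hodgecm-mathlib-LH7-p05 (g0), req620 Track A «(D-RAM) FOUR-FRAME» squad, helper lane on
h413 = stmt-HodgeConjecture-24833 (count-neutral).  β-BOARD row R8-EQ-a «THE LOCUS STRATUM ON THE EQUILATERAL KEY» (β chair F0P3a-p01 (g37) LEDGER #17∕#19 (iii)), FILE EQ-3a.  2026-09-04.
-/
import Summits.HodgeConjecture.HodgeConjecture.Theorems.F0P3cDyRamLabelledOddGlueWindowCut           -- ★ ASM-1 (this seat): `v_eq_pow_iff_le_and_not_le`, `v_add_eq_pow_iff_of_v_sub_le`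
import Summits.HodgeConjecture.HodgeConjecture.Theorems.F0P3cDyRamLabelledOddCoreHangingShell        -- ★ p861362 (LH7-p08 (g0)): `latticeInLevel_diag_latt_H_iff`
import HarnessLib

/-!
# Crux `H413`, line LH4 «(D-RAM) FOUR-FRAME» — (β) table, β-BOARD row R8-EQ-a (THE EQUILATERAL KEY, THE LOCUS STRATUM `2ρ + ℓ₀ = m`), FILE EQ-3a:
# AT THE LOCUS THE CLEAN-SHELL CUT OF THE CORE-HANGING REPRESENTATIVE `latt V_H(1,1,g)` IS THE GENERIC CLASS `|g + g₀| = 1`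

Cell `hodgecm-mathlib` (D-0151), FLOOR 0, crux item H413 = `stmt-HodgeConjecture-24833`, route `HCCMUnconditional`; squad F0∕P3c∕LH4 (β-table fan; β chair F0P3a-p01 (g37), H-line
junction LH4-p05 (g9)).  THEOREMS ONLY (no `def`, no instance, no notation, no `sorry`, default heartbeats); ★-only imports; lane `--supports stmt-HodgeConjecture-24833 --as helper`
(count-neutral); pays NO row, states NO law.  Consumer: the R8-EQ-a assembly (the `E = 0` twin of this seat's EQ-2d `…CoreHangingEquilateralWindow`), i.e. the equality half
`2ρ + d % 2 = n₂` of LH4-p05 (g9)'s ★ p862088 binder `hEqW`.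

THE MATHEMATICS (the `E = 0` twin of EQ-2c §1; chair's read, LEDGER #17).  Equilateral key `|α−1| = |β−1| = |β−α| = |ϖ|^m`, `g₀ = (β−1)∕(α−1)` (a unit with `1 − g₀` a unit);
AT THE LOCUS `2ρ + ℓ₀ = m` the ★ p861362 read of `latt(1 0 0; 1 ϖ^ρ 0; 1+g ϖ^ρ ϖ^{2ρ})` (`|g| = 1`) at `X = diag(α−1, β−1, 0)` has mixed letter `(β−1) + (α−1)g = (α−1)(g + g₀)`, so
level `ℓ₀` ALWAYS holds and level `ℓ₀ + 1` holds iff `|g + g₀| ≤ |ϖ|`; the square token at `mc` holds automatically when `2ρ + mc ≤ 2m` (both terms of its mixed letter have valuation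
`≥ 2m`).  Hence `shell ⟺ |g + g₀| = 1` (`shell_latt_coreHanging_rep_iff_locus`), and with any centre `c₀`, `|c₀ − g₀| ≤ |ϖ|`, `shell ⟺ |g + c₀| = 1` (`…_of_near`; `c₀ = g_β∕g_α` the
ratio of the sharp tokens).  In the tube regime `m ≥ 2ρ` every admissible representative is `T`-stable (★ `mapGL_latt_glued_rep_of_depths` at `t = 0`), so no stability letter
appears here.
HONEST LABEL: count-neutral; R8-EQ-a ∕ hH ∕ hRest ∕ (β-BAL) ∕ (β) ∕ T₊ OPEN; `HC_CM` is proved only modulo the 7 printed citations (2 remaining named inputs: hLiu418 =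
`stmt-HodgeConjecture-24832`, h413 = `stmt-HodgeConjecture-24833`) until rung 0 closes.
References: [Kottwitz1986BaseChangeUnits] §1 pp. 240–241 · [Rogawski1990] §4.9 Prop. 4.9.1 (a)(b) p. 55 · [Serre1980Trees] Ch. II §1.1.
-/

set_option autoImplicit false

noncomputable section

namespace Summit.HodgeConjecture.HodgeConjecture.Cruxes.H413.F0P3cDyRamLabelledOddCoreHangingLocusCut

open Matrix WithZero
open Literature.NumberTheory.Automorphic Literature.NumberTheory.Automorphic.HermitianLattice
open Literature.NumberTheory.Automorphic.UnitaryLatticeTree Literature.NumberTheory.Automorphic.UnitaryThreeFourFrame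
open Literature.NumberTheory.LocalFields Literature.NumberTheory.LocalFields.WildQuadraticDatum
open Summit.HodgeConjecture.HodgeConjecture.Cruxes.H413.F0P3cDyRamFourFramePieces
open Summit.HodgeConjecture.HodgeConjecture.Cruxes.H413.F0P3cDyRamFourFrameCensusDefs
open Summit.HodgeConjecture.HodgeConjecture.Cruxes.H413.F0P3cDyRamStageOneBDefs (mcOfRecord)
open Summit.HodgeConjecture.HodgeConjecture.Cruxes.H413.F0P3cDyRamDiagonalTorusDefs
open Summit.HodgeConjecture.HodgeConjecture.Cruxes.H413.F0P3cDyRamDiagonalStrataDefs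
open Summit.HodgeConjecture.HodgeConjecture.Cruxes.H413.F0P3cDyRamLabelledOddCoreHangingShell (latticeInLevel_diag_latt_H_iff)
open Summit.HodgeConjecture.HodgeConjecture.Cruxes.H413.F0P3cDyRamLabelledOddGlueWindowCut (v_eq_pow_iff_le_and_not_le v_add_eq_pow_iff_of_v_sub_le)
open scoped Valued WithZero Matrix MatrixGroups

variable {K : Type} [Field K] [Valued K ℤᵐ⁰] {σ : K →+* K} {ϖ : K} {d t : ℕ} {α β : K} {N₀ n₁ n₂ n₃ : ℕ}

/-- **THE LOCUS CUT OF `latt V_H(1,1,g)`, CENTRE `g₀ = (β−1)∕(α−1)`** (equilateral key `n₁ = n₂ = n₃`, locus `2ρ + d % 2 = n₂`, `2ρ + mcOfRecord d ≤ 2·n₂`; `|g| = 1`): the representative is on the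
clean shell iff `|g + g₀| = 1` (level `ℓ₀` always, level `ℓ₀ + 1` iff `|g + g₀| ≤ |ϖ|`, square token automatic). [cite: Kottwitz1986BaseChangeUnits, §1 pp. 240–241] [cite: Serre1980Trees, Ch. II §1.1] -/
theorem shell_latt_coreHanging_rep_iff_locus (hD : IsRamifiedQuadraticDatum σ ϖ d t) (hE : IsElementDatum σ ϖ N₀ α β n₁ n₂ n₃)
    {ρ : ℕ} (hρ : 1 ≤ ρ) (h12 : n₁ = n₂) (h23 : n₂ = n₃) (hloc : 2 * ρ + d % 2 = n₂) (hhi : 2 * ρ + mcOfRecord d ≤ 2 * n₂) {g : K} (hg : Valued.v g = 1) :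
    (LatticeInLevel ϖ (d % 2) (Matrix.diagonal ![α - 1, β - 1, 0]) (latt (!![1, 0, 0; 1, ϖ ^ ρ, 0; 1 * 1 + g, ϖ ^ ρ * 1, ϖ ^ (2 * ρ)] : Matrix (Fin 3) (Fin 3) K)) ∧
        ¬ LatticeInLevel ϖ (d % 2 + 1) (Matrix.diagonal ![α - 1, β - 1, 0]) (latt (!![1, 0, 0; 1, ϖ ^ ρ, 0; 1 * 1 + g, ϖ ^ ρ * 1, ϖ ^ (2 * ρ)] : Matrix (Fin 3) (Fin 3) K)) ∧
        LatticeInLevel ϖ (mcOfRecord d) (Matrix.diagonal ![(α - 1) * (α - 1), (β - 1) * (β - 1), 0])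
          (latt (!![1, 0, 0; 1, ϖ ^ ρ, 0; 1 * 1 + g, ϖ ^ ρ * 1, ϖ ^ (2 * ρ)] : Matrix (Fin 3) (Fin 3) K))) ↔
      Valued.v (g + (β - 1) / (α - 1)) = 1 := by
  classical
  obtain ⟨hσ, hvσ, hϖ, -, -, -, -⟩ := id hD
  have hϖ0 : ϖ ≠ 0 := fun h0 => by rw [h0, map_zero] at hϖ; exact WithZero.coe_ne_zero hϖ.symm
  have hvϖ : Valued.v ϖ ≠ 0 := (Valuation.ne_zero_iff _).2 hϖ0
  have hpw : ∀ a b : ℕ, Valued.v ϖ ^ a ≤ Valued.v ϖ ^ b ↔ b ≤ a := fun a b => by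
    rw [v_varpi_pow hϖ, v_varpi_pow hϖ, exp_le_exp]; omega
  have hmcdef : mcOfRecord d = 2 * ((d % 2 + 2 * d - 1 + d) / 2) := rfl
  have hα : Valued.v (α - 1) = Valued.v ϖ ^ n₂ := hE.2.2.2.2.2.2.1
  have hβ : Valued.v (β - 1) = Valued.v ϖ ^ n₂ := h12 ▸ hE.2.2.2.2.2.1
  have hγ : Valued.v (β - 1 - (α - 1)) = Valued.v ϖ ^ n₂ := by
    rw [show β - 1 - (α - 1) = -(α - β) by ring, Valuation.map_neg, h23]; exact hE.2.2.2.2.2.2.2.1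
  have hα0 : α - 1 ≠ 0 := fun h => by rw [h, map_zero] at hα; exact pow_ne_zero _ hvϖ hα.symm
  set g₀ : K := (β - 1) / (α - 1) with hg₀
  have hg₀1 : Valued.v g₀ = 1 := by rw [hg₀, map_div₀, hα, hβ, div_self (pow_ne_zero _ hvϖ)]
  have hgg₀ : Valued.v (g + g₀) ≤ 1 := (Valuation.map_add _ _ _).trans (max_le hg.le hg₀1.le)
  -- the mixed letter in `g₀`-currency
  have hmixeq : 1 * 1 * (β - 1) + (α - 1) * g = (g + g₀) * (α - 1) := by rw [hg₀]; field_simp; ring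
  have hmix : ∀ ℓ : ℕ, d % 2 ≤ ℓ → (Valued.v (1 * 1 * (β - 1) + (α - 1) * g) ≤ Valued.v ϖ ^ (ℓ + 2 * ρ) ↔ Valued.v (g + g₀) ≤ Valued.v ϖ ^ (ℓ + 2 * ρ - n₂)) := by
    intro ℓ hℓ0
    have hℓ : n₂ ≤ ℓ + 2 * ρ := by omega
    rw [hmixeq, show Valued.v ϖ ^ (ℓ + 2 * ρ) = Valued.v (ϖ ^ (ℓ + 2 * ρ - n₂) * (α - 1)) by rw [map_mul, map_pow, hα, ← pow_add]; congr 1; omega,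
      F0P3cDyRamLevelTokenHNF.v_mul_le_mul_iff_of_ne_zero hα0, map_pow]
  have hread : ∀ ℓ : ℕ, d % 2 ≤ ℓ → (LatticeInLevel ϖ ℓ (Matrix.diagonal ![α - 1, β - 1, 0])
      (latt (!![1, 0, 0; 1, ϖ ^ ρ, 0; 1 * 1 + g, ϖ ^ ρ * 1, ϖ ^ (2 * ρ)] : Matrix (Fin 3) (Fin 3) K)) ↔
      ℓ + ρ ≤ n₂ ∧ Valued.v (g + g₀) ≤ Valued.v ϖ ^ (ℓ + 2 * ρ - n₂)) := by
    intro ℓ hℓ0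
    rw [latticeInLevel_diag_latt_H_iff hϖ0 ℓ ρ (α - 1) (β - 1) (x := 1) (ζ := 1) (map_one _) (map_one _) g, hmix ℓ hℓ0, hα, hβ, hγ]
    simp only [hpw]
    constructor
    · rintro ⟨-, h2, -, h4⟩; exact ⟨by omega, h4⟩
    · rintro ⟨h1, h4⟩; exact ⟨⟨by omega, by omega⟩, by omega, by omega, h4⟩
  -- the square token is automatic
  have hsq : LatticeInLevel ϖ (mcOfRecord d) (Matrix.diagonal ![(α - 1) * (α - 1), (β - 1) * (β - 1), 0])
      (latt (!![1, 0, 0; 1, ϖ ^ ρ, 0; 1 * 1 + g, ϖ ^ ρ * 1, ϖ ^ (2 * ρ)] : Matrix (Fin 3) (Fin 3) K)) := by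
    rw [latticeInLevel_diag_latt_H_iff hϖ0 (mcOfRecord d) ρ ((α - 1) * (α - 1)) ((β - 1) * (β - 1)) (x := 1) (ζ := 1) (map_one _) (map_one _) g]
    have hA2 : Valued.v ((α - 1) * (α - 1)) = Valued.v ϖ ^ (2 * n₂) := by rw [map_mul, hα, ← pow_add, two_mul]
    have hB2 : Valued.v ((β - 1) * (β - 1)) = Valued.v ϖ ^ (2 * n₂) := by rw [map_mul, hβ, ← pow_add, two_mul]
    have hAB : Valued.v ((β - 1) * (β - 1) - (α - 1) * (α - 1)) ≤ Valued.v ϖ ^ (2 * n₂) :=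
      (Valuation.map_sub _ _ _).trans (max_le hB2.le hA2.le)
    have hmix2 : Valued.v (1 * 1 * ((β - 1) * (β - 1)) + (α - 1) * (α - 1) * g) ≤ Valued.v ϖ ^ (2 * n₂) := by
      refine (Valuation.map_add _ _ _).trans (max_le ?_ ?_)
      · rw [one_mul, one_mul, hB2]
      · rw [map_mul, hA2, hg, mul_one]
    refine ⟨⟨?_, ?_⟩, ?_, ?_, ?_⟩
    · rw [hA2, hpw]; omega
    · rw [hB2, hpw]; omega
    · exact hAB.trans ((hpw _ _).2 (by omega))
    · rw [hB2, hpw]; omega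
    · exact hmix2.trans ((hpw _ _).2 (by omega))
  constructor
  · rintro ⟨-, hnlev, -⟩
    rw [← pow_zero (Valued.v ϖ), v_eq_pow_iff_le_and_not_le hϖ _ 0, pow_zero]
    refine ⟨hgg₀, fun h => hnlev ((hread (d % 2 + 1) (by omega)).2 ⟨by omega, ?_⟩)⟩
    rwa [show d % 2 + 1 + 2 * ρ - n₂ = 0 + 1 by omega]
  · intro hcut
    refine ⟨(hread (d % 2) le_rfl).2 ⟨by omega, by rw [show d % 2 + 2 * ρ - n₂ = 0 by omega, pow_zero]; exact hgg₀⟩, fun h => ?_, hsq⟩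
    obtain ⟨-, h2⟩ := (hread (d % 2 + 1) (by omega)).1 h
    rw [show d % 2 + 1 + 2 * ρ - n₂ = 0 + 1 by omega] at h2
    rw [← pow_zero (Valued.v ϖ), v_eq_pow_iff_le_and_not_le hϖ _ 0] at hcut
    exact hcut.2 h2

/-- **THE LOCUS CUT, ANY NEARBY CENTRE**: with `|c₀ − (β−1)∕(α−1)| ≤ |ϖ|` (the token ratio `g_β∕g_α`), the representative `latt V_H(1,1,g)` (`|g| = 1`) is on the clean shell at the locus iff
`|g + c₀| = 1`. [cite: Kottwitz1986BaseChangeUnits, §1 pp. 240–241] [cite: Serre1980Trees, Ch. II §1.1] -/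
theorem shell_latt_coreHanging_rep_iff_locus_of_near (hD : IsRamifiedQuadraticDatum σ ϖ d t) (hE : IsElementDatum σ ϖ N₀ α β n₁ n₂ n₃)
    {ρ : ℕ} (hρ : 1 ≤ ρ) (h12 : n₁ = n₂) (h23 : n₂ = n₃) (hloc : 2 * ρ + d % 2 = n₂) (hhi : 2 * ρ + mcOfRecord d ≤ 2 * n₂)
    {c₀ : K} (hc₀ : Valued.v (c₀ - (β - 1) / (α - 1)) ≤ Valued.v ϖ) {g : K} (hg : Valued.v g = 1) :
    (LatticeInLevel ϖ (d % 2) (Matrix.diagonal ![α - 1, β - 1, 0]) (latt (!![1, 0, 0; 1, ϖ ^ ρ, 0; 1 * 1 + g, ϖ ^ ρ * 1, ϖ ^ (2 * ρ)] : Matrix (Fin 3) (Fin 3) K)) ∧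
        ¬ LatticeInLevel ϖ (d % 2 + 1) (Matrix.diagonal ![α - 1, β - 1, 0]) (latt (!![1, 0, 0; 1, ϖ ^ ρ, 0; 1 * 1 + g, ϖ ^ ρ * 1, ϖ ^ (2 * ρ)] : Matrix (Fin 3) (Fin 3) K)) ∧
        LatticeInLevel ϖ (mcOfRecord d) (Matrix.diagonal ![(α - 1) * (α - 1), (β - 1) * (β - 1), 0])
          (latt (!![1, 0, 0; 1, ϖ ^ ρ, 0; 1 * 1 + g, ϖ ^ ρ * 1, ϖ ^ (2 * ρ)] : Matrix (Fin 3) (Fin 3) K))) ↔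
      Valued.v (g + c₀) = 1 := by
  have h := v_add_eq_pow_iff_of_v_sub_le hD.2.2.1 (k := 0) (by rw [zero_add, pow_one]; exact hc₀) g
  rw [pow_zero] at h
  rw [shell_latt_coreHanging_rep_iff_locus hD hE hρ h12 h23 hloc hhi hg, h]

end Summit.HodgeConjecture.HodgeConjecture.Cruxes.H413.F0P3cDyRamLabelledOddCoreHangingLocusCut

end
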